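import Mathlib.NumberTheory.NumberField.Discriminant.Different
import Mathlib.NumberTheory.RamificationInertia.Galois
import Mathlib.FieldTheory.Galois.IsGaloisGroup
import Mathlib.RingTheory.Ideal.Pointwise
import Mathlib.RingTheory.Trace.Basic
import HarnessLib

/-!
# The different of a Galois extension of degree prime to `p` divides `p`; a discriminant bound

Topic `NumberTheory/NumberFields`; theorems only (no definition, no named fact). Let `L/K` be a
Galois extension of number fields whose degree `n = [L : K]` is prime to a rational prime `p`, and
`𝔔` a prime of `𝓞 L` above `p` with ramification index `e = e(𝔔 | 𝔮)`, `𝔮 = 𝔔 ∩ 𝓞 K`. Then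
`𝔔` is *tamely* ramified (as `e ∣ n`), and Dedekind's different theorem gives
`v_𝔔(𝔇_{L/K}) = e - 1` (Neukirch, *Algebraic Number Theory*, III (2.6): "`s = e - 1` if `𝔓` is
tamely ramified"; Serre, *Local Fields*, III §6 Prop. 13). We prove the inequality
`v_𝔔(𝔇_{L/K}) ≤ e - 1` that we need, in the form

* `map_under_le_pow_succ_of_pow_dvd_differentIdeal` — **`v_𝔔(𝔇(𝓞 L/𝓞 K)) < e`** (stated as:
  `𝔔^k ∣ 𝔇 ⟹ 𝔮 𝓞 L ⊆ 𝔔^{k+1}`),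

by Mathlib's trace criterion `not_dvd_differentIdeal_of_intTrace_not_mem` (`𝔔^e ∤ 𝔇` as soon as
some `x` in the prime-to-`𝔔` part `Q` of `𝔮 𝓞 L = 𝔔^e Q` has `Tr_{L/K}(x) ∉ 𝔮`) and a Galois
computation of the trace replacing the local structure theory of the printed proofs: choose
`x ∈ Q` with `x ≡ 1 (mod 𝔔)`; then `Tr(x) = Σ_{σ ∈ G} σx ≡ #D_𝔔 (mod 𝔔)`, because `σ x ≡ 1` for
`σ` in the decomposition group `D_𝔔` and `σ x ∈ 𝔔` for the other `σ` (`x ∈ Q ⊆ σ⁻¹𝔔`); and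
`#D_𝔔 ∣ n` is prime to `p ∈ 𝔔`, so `Tr(x) ∉ 𝔔`. Consequences:

* `differentIdeal_dvd_span_natCast_of_coprime_degree` — if moreover `L/K` is unramified at every prime not above
  `p`, then **`𝔇(𝓞 L/𝓞 K) ∣ (p)`** (compare the `𝔔`-adic valuations: `e - 1 < e ≤ v_𝔔(p)`);
* `natAbs_discr_le_of_coprime_of_unramified` — hence **`|d_L| ≤ p^{[L:ℚ]} · |d_K|^{[L:K]}`**
  (tower formula `|d_L| = N(𝔇_{L/K}) |d_K|^{[L:K]}`, Mathlib's
  `NumberField.natAbs_discr_eq_absNorm_differentIdeal_mul_natAbs_discr_pow`; Neukirch III (2.10)).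

Used (with `p = 2`, `n` odd) for the class fields of the characters of the odd-order group
`cl(ℤ[√-p])` in the discharge of `Literature.Computability.Cryptography.Csidh.jmv_smallPrimesGenerate`.
Mathlib (this pin) has the different, `𝔓 ∣ 𝔇 ↔` ramified (`dvd_differentIdeal_iff`), the lower
bound `𝔓^{e-1} ∣ 𝔇` (`pow_sub_one_dvd_differentIdeal`) and the trace criterion, but not the tame
equality (searched `differentIdeal` + `tame`/`sub_one`).

## References

* J. Neukirch, *Algebraic Number Theory*, Grundlehren 322, Springer 1999, Ch. III §2, Thm. (2.6)
  and (2.9)–(2.10). [NeukirchANT1999]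
* J.-P. Serre, *Local Fields*, GTM 67, Springer 1979, Ch. III §6, Prop. 13 and Remark.
  [SerreLocalFields1979]
-/

noncomputable section

open NumberField Ideal
open scoped Pointwise

namespace Literature.NumberTheory.NumberFields

variable {K L : Type*} [Field K] [NumberField K] [Field L] [NumberField L] [Algebra K L]

attribute [local instance] Ideal.Quotient.field FractionRing.liftAlgebra

/-- In a Galois extension of number fields, `Tr_{L/K}(x) = Σ_{σ ∈ Gal(L/K)} σ x` on `𝓞 L`
(Mathlib's `trace_eq_sum_automorphisms` with `Algebra.algebraMap_intTrace`). [folklore] -/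
theorem algebraMap_intTrace_eq_sum_smul [IsGalois K L] (x : 𝓞 L) :
    algebraMap (𝓞 K) (𝓞 L) (Algebra.intTrace (𝓞 K) (𝓞 L) x) = ∑ σ : L ≃ₐ[K] L, σ • x := by
  apply FaithfulSMul.algebraMap_injective (𝓞 L) L
  rw [← IsScalarTower.algebraMap_apply, IsScalarTower.algebraMap_apply (𝓞 K) K L,
    Algebra.algebraMap_intTrace (A := 𝓞 K) (K := K) (L := L) (B := 𝓞 L), map_sum,
    trace_eq_sum_automorphisms]
  rfl

/-- **Tame different bound via the trace.** Let `L/K` be a Galois extension of number fields of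
degree prime to the rational prime `p`, and `𝔔 ∋ p` a maximal ideal of `𝓞 L` with ramification
index `e` over `𝔮 = 𝔔 ∩ 𝓞 K` (the multiplicity of `𝔔` in `𝔮 𝓞 L`). Then `𝔔^e ∤ 𝔇(𝓞 L / 𝓞 K)`,
i.e. `v_𝔔(𝔇) ≤ e - 1` (Dedekind; Neukirch III (2.6), tame case) — stated without naming `e`: if
`𝔔^k ∣ 𝔇` then `𝔮 𝓞 L ⊆ 𝔔^{k+1}` (`k < e`). Proof: with `𝔮𝓞 L = 𝔔^e Q`, `𝔔 + Q = 1`, pick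
`x ∈ Q`, `x ≡ 1 (mod 𝔔)`; then `Tr(x) = Σ_σ σ x ≡ #D_𝔔 ≢ 0 (mod 𝔔)` and Mathlib's
`not_dvd_differentIdeal_of_intTrace_not_mem` gives `𝔔^e ∤ 𝔇`.
[cite: NeukirchANT1999, Ch. III §2 Thm. (2.6)] -/
theorem map_under_le_pow_succ_of_pow_dvd_differentIdeal [IsGalois K L] {p : ℕ} (hp : p.Prime)
    (hcop : Nat.Coprime p (Module.finrank K L)) (𝔔 : Ideal (𝓞 L)) [𝔔.IsMaximal]
    (hp𝔔 : (p : 𝓞 L) ∈ 𝔔) {e : ℕ} (hdvd : 𝔔 ^ e ∣ differentIdeal (𝓞 K) (𝓞 L)) :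
    Ideal.map (algebraMap (𝓞 K) (𝓞 L)) (𝔔.under (𝓞 K)) ≤ 𝔔 ^ (e + 1) := by
  classical
  set 𝔮 : Ideal (𝓞 K) := 𝔔.under (𝓞 K) with h𝔮
  set I : Ideal (𝓞 L) := Ideal.map (algebraMap (𝓞 K) (𝓞 L)) 𝔮 with hI
  have h𝔔0 : 𝔔 ≠ ⊥ := by
    intro h
    rw [h, Ideal.mem_bot] at hp𝔔
    exact hp.ne_zero (by exact_mod_cast hp𝔔)
  have h𝔮0 : 𝔮 ≠ ⊥ := mt Ideal.eq_bot_of_comap_eq_bot h𝔔0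
  have hI0 : I ≠ ⊥ := (Ideal.map_eq_bot_iff_of_injective
    (FaithfulSMul.algebraMap_injective (𝓞 K) (𝓞 L))).not.mpr h𝔮0
  obtain ⟨Q, hcop𝔔Q, hIQ⟩ := Ideal.eq_prime_pow_mul_coprime hI0 𝔔
  set c := Multiset.count 𝔔 (UniqueFactorizationMonoid.normalizedFactors I) with hc
  -- it suffices to show `𝔔^c ∤ 𝔇`: then `e < c` and `I = 𝔔^c Q ≤ 𝔔^(e+1)`
  suffices hmain : ¬ 𝔔 ^ c ∣ differentIdeal (𝓞 K) (𝓞 L) by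
    have hlt : e < c := by
      by_contra hle
      exact hmain ((pow_dvd_pow 𝔔 (not_lt.1 hle)).trans hdvd)
    rw [hIQ]
    exact Ideal.mul_le_right.trans (Ideal.pow_le_pow_right hlt)
  -- `x ∈ Q` with `x ≡ 1 mod 𝔔`
  obtain ⟨a, ha, x, hxQ, hax⟩ :=
    Submodule.mem_sup.1 ((hcop𝔔Q ▸ Submodule.mem_top : (1 : 𝓞 L) ∈ 𝔔 ⊔ Q))
  have hx1 : x - 1 ∈ 𝔔 := by
    have : x - 1 = -a := by rw [← hax]; ring
    rw [this]
    exact 𝔔.neg_mem ha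
  -- `Q ≤ 𝔔'` for every prime `𝔔' ≠ 𝔔` of `𝓞 L` above `𝔮`
  have hQle : ∀ 𝔔' : Ideal (𝓞 L), 𝔔'.IsPrime → 𝔔'.under (𝓞 K) = 𝔮 → 𝔔' ≠ 𝔔 → Q ≤ 𝔔' := by
    intro 𝔔' h𝔔' hunder hne
    have hIle : I ≤ 𝔔' := by
      rw [hI, Ideal.map_le_iff_le_comap]
      exact le_of_eq hunder.symm
    rw [hIQ] at hIle
    rcases (Ideal.IsPrime.mul_le h𝔔').1 hIle with h | h
    · exfalso
      by_cases hc0 : c = 0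
      · rw [hc0, pow_zero, Ideal.one_eq_top] at h
        exact h𝔔'.ne_top (top_le_iff.1 h)
      · have h' : 𝔔 ≤ 𝔔' := (Ideal.IsPrime.pow_le_iff hc0).1 h
        exact hne ((IsMaximal.eq_of_le inferInstance h𝔔'.ne_top h').symm)
    · exact h
  -- the stabiliser (decomposition group) `D` of `𝔔`
  let D : Subgroup (L ≃ₐ[K] L) := MulAction.stabilizer (L ≃ₐ[K] L) 𝔔
  have hsmul_of_mem : ∀ σ : L ≃ₐ[K] L, σ ∈ D → Ideal.Quotient.mk 𝔔 (σ • x) = 1 := by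
    intro σ hσ
    have hσ𝔔 : σ • 𝔔 = 𝔔 := MulAction.mem_stabilizer_iff.1 hσ
    have hmem : σ • (x - 1) ∈ σ • 𝔔 := Ideal.smul_mem_pointwise_smul σ (x - 1) 𝔔 hx1
    rw [hσ𝔔, smul_sub, smul_one] at hmem
    rw [← (Ideal.Quotient.mk 𝔔).map_one]
    exact Ideal.Quotient.eq.2 hmem
  have hsmul_of_not_mem : ∀ σ : L ≃ₐ[K] L, σ ∉ D → Ideal.Quotient.mk 𝔔 (σ • x) = 0 := by
    intro σ hσ
    rw [Ideal.Quotient.eq_zero_iff_mem,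
      ← Ideal.mem_inv_pointwise_smul_iff (a := σ) (S := 𝔔) (x := x)]
    refine hQle (σ⁻¹ • 𝔔) (Ideal.IsPrime.smul σ⁻¹) ?_ ?_ hxQ
    · rw [h𝔮]
      exact Ideal.under_smul (𝓞 K) 𝔔 σ⁻¹
    · intro h
      apply hσ
      rw [MulAction.mem_stabilizer_iff]
      calc σ • 𝔔 = σ • (σ⁻¹ • 𝔔) := by rw [h]
        _ = 𝔔 := smul_inv_smul σ 𝔔
  -- `Tr(x) ≡ #D (mod 𝔔)`
  have htrace : Ideal.Quotient.mk 𝔔 (algebraMap (𝓞 K) (𝓞 L) (Algebra.intTrace (𝓞 K) (𝓞 L) x)) =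
      (Nat.card D : 𝓞 L ⧸ 𝔔) := by
    rw [algebraMap_intTrace_eq_sum_smul, map_sum, ← Finset.sum_filter_add_sum_filter_not Finset.univ
      (fun σ : L ≃ₐ[K] L => σ ∈ D)]
    rw [Finset.sum_congr rfl (fun σ hσ => hsmul_of_mem σ (Finset.mem_filter.1 hσ).2),
      Finset.sum_congr rfl (fun σ hσ => hsmul_of_not_mem σ (Finset.mem_filter.1 hσ).2)]
    simp only [Finset.sum_const, nsmul_eq_mul, mul_one, mul_zero, add_zero]
    congr 1
    rw [Nat.card_eq_fintype_card, Fintype.card_subtype]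
  -- `#D ∣ #G = [L : K]` is prime to `p`, hence a unit mod `𝔔 ∋ p`
  have hDcard : Nat.Coprime p (Nat.card D) :=
    Nat.Coprime.coprime_dvd_right ((Subgroup.card_subgroup_dvd_card D).trans
      (by rw [IsGalois.card_aut_eq_finrank])) hcop
  have hunit : (Nat.card D : 𝓞 L ⧸ 𝔔) ≠ 0 := by
    obtain ⟨u, v, huv⟩ := Nat.isCoprime_iff_coprime.2 hDcard
    intro h0
    have hp0 : (p : 𝓞 L ⧸ 𝔔) = 0 := by
      rw [← map_natCast (Ideal.Quotient.mk 𝔔), Ideal.Quotient.eq_zero_iff_mem]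
      exact hp𝔔
    have : ((u * p + v * (Nat.card D) : ℤ) : 𝓞 L ⧸ 𝔔) = 1 := by rw [huv]; simp
    rw [Int.cast_add, Int.cast_mul, Int.cast_mul, Int.cast_natCast, Int.cast_natCast, hp0, h0,
      mul_zero, mul_zero, add_zero] at this
    exact zero_ne_one this
  -- conclude with the trace criterion
  refine not_dvd_differentIdeal_of_intTrace_not_mem (𝓞 K) (𝔔 ^ c) Q hIQ.symm x hxQ ?_
  intro hmem
  apply hunit
  rw [← htrace, Ideal.Quotient.eq_zero_iff_mem]
  have hcne : c ≠ 0 := by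
    have hdvdI : 𝔔 ∣ I := Ideal.dvd_iff_le.2 (by rw [hI, Ideal.map_le_iff_le_comap])
    have hirr : Irreducible 𝔔 := (Ideal.prime_of_isPrime h𝔔0 inferInstance).irreducible
    obtain ⟨q, hq, hq'⟩ := UniqueFactorizationMonoid.exists_mem_normalizedFactors_of_dvd hI0 hirr hdvdI
    rw [hc, Ne, Multiset.count_eq_zero, associated_iff_eq.1 hq']
    exact fun h => h hq
  have hxI : algebraMap (𝓞 K) (𝓞 L) (Algebra.intTrace (𝓞 K) (𝓞 L) x) ∈ I :=
    Ideal.mem_map_of_mem _ hmem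
  rw [hIQ] at hxI
  exact (Ideal.mul_le_right.trans (Ideal.pow_le_self hcne)) hxI

/-- **The different of a Galois extension of degree prime to `p`, unramified away from `p`,
divides `p`.** With `L/K` Galois of degree prime to `p` and unramified at every prime of `𝓞 L`
not containing `p`: `𝔇(𝓞 L/𝓞 K) ∣ p 𝓞 L` — at a prime `𝔔 ∌ p` the exponent of `𝔔` in `𝔇` is `0`
(Mathlib's `not_dvd_differentIdeal_iff`), at `𝔔 ∋ p` it is `< e(𝔔|𝔮) ≤ v_𝔔(p)`
(`map_under_le_pow_succ_of_pow_dvd_differentIdeal`). (Neukirch III (2.6): in the tame case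
`𝔇 = ∏ 𝔓^{e_𝔓 - 1}`, which divides `∏_{𝔓 ∣ p} 𝔓^{e_𝔓} ∣ (p)`.)
[cite: NeukirchANT1999, Ch. III §2 Thm. (2.6)] -/
theorem differentIdeal_dvd_span_natCast_of_coprime_degree [IsGalois K L] {p : ℕ} (hp : p.Prime)
    (hcop : Nat.Coprime p (Module.finrank K L))
    (hunr : ∀ (𝔔 : Ideal (𝓞 L)) [𝔔.IsMaximal], (p : 𝓞 L) ∉ 𝔔 → Algebra.IsUnramifiedAt (𝓞 K) 𝔔) :
    differentIdeal (𝓞 K) (𝓞 L) ∣ Ideal.span {(p : 𝓞 L)} := by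
  classical
  have h𝒟 : differentIdeal (𝓞 K) (𝓞 L) ≠ ⊥ := differentIdeal_ne_bot
  have hJ : Ideal.span {(p : 𝓞 L)} ≠ ⊥ := by
    rw [Ne, Ideal.span_singleton_eq_bot]
    exact_mod_cast hp.ne_zero
  rw [UniqueFactorizationMonoid.dvd_iff_normalizedFactors_le_normalizedFactors h𝒟 hJ,
    Multiset.le_iff_count]
  intro 𝔔
  by_cases hmem : 𝔔 ∈ UniqueFactorizationMonoid.normalizedFactors (differentIdeal (𝓞 K) (𝓞 L))
  · have hprime : Prime 𝔔 := UniqueFactorizationMonoid.prime_of_normalized_factor 𝔔 hmem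
    have hirr : Irreducible 𝔔 := hprime.irreducible
    have h𝔔0 : 𝔔 ≠ ⊥ := hprime.ne_zero
    haveI h𝔔p : 𝔔.IsPrime := Ideal.isPrime_of_prime hprime
    haveI : 𝔔.IsMaximal := Ideal.IsPrime.isMaximal h𝔔p h𝔔0
    -- `p ∈ 𝔔`, for otherwise `𝔔` is unramified and does not divide the different
    have hp𝔔 : (p : 𝓞 L) ∈ 𝔔 := by
      by_contra hnot
      exact (not_dvd_differentIdeal_iff.2 (hunr 𝔔 hnot))
        (UniqueFactorizationMonoid.dvd_of_mem_normalizedFactors hmem)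
    set n := Multiset.count 𝔔
      (UniqueFactorizationMonoid.normalizedFactors (differentIdeal (𝓞 K) (𝓞 L))) with hn
    have hpow : 𝔔 ^ n ∣ differentIdeal (𝓞 K) (𝓞 L) := by
      rw [pow_dvd_iff_le_emultiplicity,
        UniqueFactorizationMonoid.emultiplicity_eq_count_normalizedFactors hirr h𝒟, normalize_eq 𝔔]
    have hle := map_under_le_pow_succ_of_pow_dvd_differentIdeal hp hcop 𝔔 hp𝔔 hpow
    -- `(p) ≤ 𝔮 𝓞 L ≤ 𝔔^(n+1)`
    have hJle : Ideal.span {(p : 𝓞 L)} ≤ 𝔔 ^ (n + 1) := by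
      refine le_trans ?_ hle
      rw [Ideal.span_singleton_le_iff_mem]
      have hpK : (p : 𝓞 K) ∈ 𝔔.under (𝓞 K) := by
        rw [Ideal.mem_under, map_natCast]
        exact hp𝔔
      have := Ideal.mem_map_of_mem (algebraMap (𝓞 K) (𝓞 L)) hpK
      rwa [map_natCast] at this
    have hdvdJ : 𝔔 ^ (n + 1) ∣ Ideal.span {(p : 𝓞 L)} := Ideal.dvd_iff_le.2 hJle
    rw [pow_dvd_iff_le_emultiplicity,
      UniqueFactorizationMonoid.emultiplicity_eq_count_normalizedFactors hirr hJ, normalize_eq 𝔔,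
      Nat.cast_le] at hdvdJ
    omega
  · rw [Multiset.count_eq_zero_of_notMem hmem]
    exact Nat.zero_le _

/-- **Discriminant bound for a Galois extension of degree prime to `p` unramified away from `p`**:
`|d_L| ≤ p^{[L:ℚ]} · |d_K|^{[L:K]}`, from the tower formula `|d_L| = N(𝔇_{L/K}) · |d_K|^{[L:K]}`
(Neukirch III (2.10); Mathlib's `natAbs_discr_eq_absNorm_differentIdeal_mul_natAbs_discr_pow`) and
`𝔇_{L/K} ∣ (p)`, `N((p)) = p^{[L:ℚ]}`. [cite: NeukirchANT1999, Ch. III §2 (2.9)–(2.10)] -/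
theorem natAbs_discr_le_of_coprime_of_unramified [IsGalois K L] {p : ℕ} (hp : p.Prime)
    (hcop : Nat.Coprime p (Module.finrank K L))
    (hunr : ∀ (𝔔 : Ideal (𝓞 L)) [𝔔.IsMaximal], (p : 𝓞 L) ∉ 𝔔 → Algebra.IsUnramifiedAt (𝓞 K) 𝔔) :
    (discr L).natAbs ≤ p ^ Module.finrank ℚ L * (discr K).natAbs ^ Module.finrank K L := by
  rw [NumberField.natAbs_discr_eq_absNorm_differentIdeal_mul_natAbs_discr_pow K (𝓞 K) L (𝓞 L)]
  refine Nat.mul_le_mul_right _ ?_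
  obtain ⟨C, hC⟩ := differentIdeal_dvd_span_natCast_of_coprime_degree hp hcop hunr
  have hJ : Ideal.span {(p : 𝓞 L)} ≠ ⊥ := by
    rw [Ne, Ideal.span_singleton_eq_bot]
    exact_mod_cast hp.ne_zero
  have hC0 : C ≠ ⊥ := by
    rintro rfl
    rw [mul_bot] at hC
    exact hJ hC
  have hnorm : Ideal.absNorm (Ideal.span {(p : 𝓞 L)}) = p ^ Module.finrank ℚ L := by
    rw [Ideal.absNorm_span_singleton, ← map_natCast (algebraMap ℤ (𝓞 L)), Algebra.norm_algebraMap,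
      Int.natAbs_pow, Int.natAbs_natCast, RingOfIntegers.rank]
  have hmul : Ideal.absNorm (Ideal.span {(p : 𝓞 L)}) =
      Ideal.absNorm (differentIdeal (𝓞 K) (𝓞 L)) * Ideal.absNorm C := by
    rw [hC, map_mul]
  have hCpos : 0 < Ideal.absNorm C := Nat.pos_of_ne_zero (mt Ideal.absNorm_eq_zero_iff.1 hC0)
  rw [← hnorm, hmul]
  exact Nat.le_mul_of_pos_right _ hCpos

end Literature.NumberTheory.NumberFields

end
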